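import Literature.IUT.HodgeTheaters.InitialThetaDataTorsionMonodromyUnramified
import Literature.IUT.HodgeTheaters.InitialThetaDataTorsionMonodromyInertia
import Literature.IUT.HodgeTheaters.InitialThetaDataCor12Derived
import Literature.IUT.HodgeTheaters.PuncturedEllipticCoveringsCuspsProofs
import HarnessLib

/-!
# [IUTchI] §1 p.37 / Def 3.1 (d): the 4-label §1 data of the semidirect models carry NO cusp Galois action
# (HONESTY LEMMA «regeom-no-CG»), and what `CuspGalois` buys for the v-next datum `UnramifiedTorsionMonodromy`
# (proof-only companion of `…TorsionMonodromyModel{KLevel,Geometry,Inertia}.lean`, `…Unramified.lean`)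

S. Mochizuki, *Inter-universal Teichmüller theory I*, kurims manuscript (May 2020), §1 p. 37 «`ε′, ε″` for the two
cusps of `X̲` that lie over `ε`», §3 Definition 3.1 (d) p. 62 «`X̲_K` of type `(1, l-tors)` [cf. [EtTh], Definition
2.1]» (where [EtTh] Def 2.1 p. 36: «a quotient onto a free `(ℤ/lℤ)`-module `Q` of rank `1` such that the restricted map
`Δ̄^ell_X → Q` is still surjective, but the restricted map `D_x → Q` is trivial. Denote the corresponding covering by
`X̲^log → X^log`» — so the one cusp of `X` SPLITS COMPLETELY in the degree-`l` covering `X̲ → X`: `X̲` has `l` cusps,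
permuted simply transitively by `Gal(X̲/X) ≅ Q`) ([IUTchI] §1 p.37, Def 3.1 (d) p.62) [claim: Mochizuki2012, status:
disputed] (D-0012 claim key; series status DISPUTED — this file is finite group theory about the cell's own typed
INTERFACE `PuncturedEllipticData.CuspGalois` and its semidirect MODELS; nothing of the series is asserted; no side taken
on [IUTchIII] Cor. 3.12).

## WHY (abc-iut-L5-lead gen 6 RULINGS #71 (2) «GO regeom-no-CG»; finding abc-iut-L5-t8 g7 STATUS 13:26:03Z, adopted; count
## confirmed by the interface owner abc-iut-L5-t1 g5 13:36:04Z)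

abc-iut-L5-t1's interface `PuncturedEllipticData.CuspGalois` (`PuncturedEllipticCoveringsCusps.lean`; laws `free`,
`transitive`) makes the orbit map `Π_X/Π_X̲ ⥲ Cusp(X̲)` a bijection — kernel theorem of record
`CuspGalois.card_cusp : Nat.card D.Cusp = [Π_X : Π_X̲]` (abc-iut-L5-t1, `PuncturedEllipticCoveringsCuspsProofs.lean`,
p425290), hence `InitialThetaData.pe_card_cusp : Nat.card D.geom.pe.Cusp = l` at every initial Θ-datum (Def 3.1 (d),
`InitialThetaDataCor12Derived.lean`).  The abc-iut-L5-t8 lineage's semidirect models (`TorsionMonodromyModel.pedOf`, hence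
`InitialThetaData.regeom`; NV-L5 #45 `TorsionMonodromy`, #47 `tau_inertia`/`hI`, `UnramifiedTorsionMonodromy`) type the
cusps of `X̲_K` as FOUR LABELS `ULift (Fin 4)` with `l ≥ 5` — so they carry NO `CuspGalois` term.  This file makes that
scope restriction KERNEL-VISIBLE (RULINGS #71: any `Nonempty (D.LocalArrowLaw CG hS …)`-type corollary AT SUCH A DATUM
would be vacuous in `CG` and is forbidden), citing the existing count BY NAME (nothing restated), and records conversely
what `CG` buys at a datum that carries it.

## WHAT (proof-only; 0 `def`, no `instance`, no notation, no new `Prop` fact)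

* `PuncturedEllipticData.CuspGalois.isEmpty_of_card_ne` — `Nat.card Cusp ≠ [Π_X : Π_X̲] ⇒ IsEmpty D.CuspGalois`
  (contrapositive of abc-iut-L5-t1's `CuspGalois.card_cusp`);
* `TorsionMonodromyModel.card_cusp_pedOf` (`= 4`), **`TorsionMonodromyModel.isEmpty_cuspGalois_pedOf`** (the `K`-level
  model `pedOf G g`, `l` prime, `#E_F[l](F̄) = l²`, `g ≠ 1`: `[Π_X : Π_X̲] = l ≥ 5 ≠ 4`);
* `InitialThetaData.isEmpty_cuspGalois_of_card_ne` (ANY initial Θ-datum: `Nat.card Cusp ≠ l ⇒ IsEmpty CuspGalois`, via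
  `pe_card_cusp`), `InitialThetaData.card_cusp_regeom` (`= 4`) and
  **`InitialThetaData.isEmpty_cuspGalois_regeom : IsEmpty D₀.regeom.geom.pe.CuspGalois`**;
* conversely, at a datum CARRYING `CG` (over abc-iut-L5-d5's `TorsionMonodromy.tau_inertia_all_iff_one`, p448726, and the
  v-next datum `UnramifiedTorsionMonodromy`, p448163): `InitialThetaData.nonempty_unramifiedTorsionMonodromy_of_tau_inertia_ε1`
  and **`InitialThetaData.nonempty_unramifiedTorsionMonodromy_iff (CG) :
  Nonempty D.UnramifiedTorsionMonodromy ↔ ∃ M : D.TorsionMonodromy, ∀ k ∈ I_{ε′}, M.tau (embK k) = 0`** — under `CG`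
  the v-next binder is EXACTLY the v1 binder pair `{M, hI}` (binder bookkeeping for the certificate writers).

HONEST LABEL.  A SCOPE statement about the lineage's MODELS (their NV rows witness binder sets WITHOUT `CG` only); it says
nothing about the genuine curve, where `X̲_K` has `l` cusps and a cusp Galois action exists.  Model ≠ genuine datum;
typed ≠ inhabited ≠ discharged; nothing here bears on [IUTchIII] Cor. 3.12.
-/

noncomputable section

namespace Literature.IUT.HodgeTheaters

universe u v w

open scoped WeierstrassCurve.Affine Classical

/-! ## Contrapositive of the cusp count -/

namespace PuncturedEllipticData

variable {D : PuncturedEllipticData.{u}}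

/-- A §1 datum whose number of cusp labels differs from `[Π_X : Π_X̲]` carries NO cusp Galois action (abc-iut-L5-t1's
`CuspGalois.card_cusp`: the orbit map `Π_X/Π_X̲ ⥲ Cusp(X̲)` is a bijection — the cusp of `X` splits completely in
`X̲ → X`). [cite: Mochizuki2012, IUTchI §1 p.37] -/
theorem CuspGalois.isEmpty_of_card_ne (h : Nat.card D.Cusp ≠ D.PiXbar.relIndex D.PiX) : IsEmpty D.CuspGalois :=
  ⟨fun C => h C.card_cusp⟩

end PuncturedEllipticData

/-! ## The `K`-level semidirect model `pedOf G g`: four cusp labels, `[Π_X : Π_X̲] = l ≥ 5` -/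

namespace TorsionMonodromyModel

open Literature.AnabelianGeometry.AbsoluteAnabelian

variable {F : Type u} [Field F] {E : WeierstrassCurve F} {Fbar : Type u} [Field Fbar] [Algebra F Fbar] {l : ℕ}
  (G : Type u) [Group G] [TopologicalSpace G] [IsTopologicalGroup G] [CompactSpace G] [TotallyDisconnectedSpace G]
  [E.IsElliptic] [NeZero l]

/-- The `K`-level model has exactly four cusp LABELS (`ε⁰, ε′, ε″, 2ε`). [cite: Mochizuki2012, IUTchI §1 p.37] -/
theorem card_cusp_pedOf (g : Tors E Fbar l) (h5 : 5 ≤ l) (h6 : l.Coprime 6) :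
    Nat.card (pedOf (E := E) G g h5 h6).Cusp = 4 := by
  show Nat.card (ULift.{u} (Fin 4)) = 4
  rw [Nat.card_ulift, Nat.card_eq_fintype_card, Fintype.card_fin]

/-- **The `K`-level model carries NO cusp Galois action** (`l` prime, `#E_F[l](F̄) = l²`, `g ≠ 1`): `CuspGalois` would
force `4 = #Cusp = [Π_X : Π_X̲] = l ≥ 5`.  HONEST SCOPE of every `pedOf`-based non-vacuity witness: binder sets
WITHOUT `CG` only. [cite: Mochizuki2012, IUTchI §1 p.37] -/
theorem isEmpty_cuspGalois_pedOf (hl : l.Prime) (hcard : Nat.card (Tors E Fbar l) = l ^ 2) {g : Tors E Fbar l}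
    (hg : g ≠ 1) (h5 : 5 ≤ l) (h6 : l.Coprime 6) : IsEmpty (pedOf (E := E) G g h5 h6).CuspGalois := by
  apply PuncturedEllipticData.CuspGalois.isEmpty_of_card_ne
  rw [card_cusp_pedOf, pedOf_PiXbar]
  show 4 ≠ (lift G (Dih.dXbar F E g)).relIndex (lift G (Dih.dX F E))
  rw [lift_relIndex, Dih.dXbar_relIndex_dX hl hcard hg]
  omega

end TorsionMonodromyModel

/-! ## At initial Θ-data -/

namespace InitialThetaData

section General

variable {F : Type u} {K : Type v} {Fbar : Type w} [Field F] [NumberField F] [Field K] [NumberField K]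
  [Algebra F K] [Field Fbar] [Algebra F Fbar] [Algebra K Fbar]
  {E : WeierstrassCurve F} [E.IsElliptic] {l : ℕ} {Pb : BadPlacePredicates K}

/-- At ANY initial Θ-datum, a §1 datum whose number of cusp labels is not `l` carries NO cusp Galois action
(`InitialThetaData.pe_card_cusp`: `#Cusp(X̲_K) = [Π_{X_K} : Π_{X̲_K}] = l`, Def 3.1 (d) «of type `(1, l-tors)`»).
[cite: Mochizuki2012, IUTchI Def 3.1 (d) p.62] -/
theorem isEmpty_cuspGalois_of_card_ne (D : InitialThetaData F K Fbar E l Pb) (h : Nat.card D.geom.pe.Cusp ≠ l) :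
    IsEmpty D.geom.pe.CuspGalois :=
  ⟨fun C => h (D.pe_card_cusp C)⟩

/-- With a cusp Galois action, a v1 torsion monodromy killing `I_{ε′}` upgrades to the v-next datum (abc-iut-L5-d5's
`TorsionMonodromy.tau_inertia_all_iff_one`: all cuspidal inertia groups have the same `τ`-image).
[cite: Mochizuki2012, IUTchI §1 p.37] -/
theorem nonempty_unramifiedTorsionMonodromy_of_tau_inertia_ε1 {D : InitialThetaData F K Fbar E l Pb}
    (CG : D.geom.pe.CuspGalois) (M : D.TorsionMonodromy)
    (hI : ∀ k ∈ D.geom.pe.inertia D.geom.pe.ε1, M.tau (D.geom.embK k) = 0) :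
    Nonempty D.UnramifiedTorsionMonodromy :=
  ⟨⟨M, (TorsionMonodromy.tau_inertia_all_iff_one CG M).mpr hI⟩⟩

/-- **Under `CG`, the v-next binder `Nonempty D.UnramifiedTorsionMonodromy` is EXACTLY the v1 binder pair
`{M : D.TorsionMonodromy, hI}`** (forward direction binder-free).  Binder bookkeeping for the layer-5 certificate.
[cite: Mochizuki2012, IUTchI §1 p.37] -/
theorem nonempty_unramifiedTorsionMonodromy_iff {D : InitialThetaData F K Fbar E l Pb} (CG : D.geom.pe.CuspGalois) :
    Nonempty D.UnramifiedTorsionMonodromy ↔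
      ∃ M : D.TorsionMonodromy, ∀ k ∈ D.geom.pe.inertia D.geom.pe.ε1, M.tau (D.geom.embK k) = 0 := by
  constructor
  · rintro ⟨M⟩
    exact ⟨M.toTorsionMonodromy, M.tau_inertia_ε1⟩
  · rintro ⟨M, hI⟩
    exact nonempty_unramifiedTorsionMonodromy_of_tau_inertia_ε1 CG M hI

end General

section Regeom

variable {F K Fbar : Type u} [Field F] [NumberField F] [Field K] [NumberField K] [Algebra F K] [Field Fbar]
  [Algebra F Fbar] [Algebra K Fbar] {E : WeierstrassCurve F} [E.IsElliptic] {l : ℕ} {Pb : BadPlacePredicates K}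

/-- The re-geometrised datum's §1 datum has exactly four cusp LABELS. [cite: Mochizuki2012, IUTchI §1 p.37] -/
theorem card_cusp_regeom (D₀ : InitialThetaData F K Fbar E l Pb) : Nat.card D₀.regeom.geom.pe.Cusp = 4 := by
  show Nat.card (ULift.{u} (Fin 4)) = 4
  rw [Nat.card_ulift, Nat.card_eq_fintype_card, Fintype.card_fin]

/-- **HONESTY LEMMA «regeom-no-CG»: the re-geometrised initial Θ-datum carries NO cusp Galois action** —
`IsEmpty D₀.regeom.geom.pe.CuspGalois` (`#Cusp = 4 ≠ l ≥ 5`).  Consequently the lineage's NV witnesses at `regeom`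
(NV-L5 #45 `TorsionMonodromy`, #47 `tau_inertia`/`hI`, `UnramifiedTorsionMonodromy`) concern binder sets WITHOUT
`CG : D.geom.pe.CuspGalois` only. [cite: Mochizuki2012, IUTchI Def 3.1 (d) p.62] -/
theorem isEmpty_cuspGalois_regeom (D₀ : InitialThetaData F K Fbar E l Pb) : IsEmpty D₀.regeom.geom.pe.CuspGalois := by
  apply D₀.regeom.isEmpty_cuspGalois_of_card_ne
  rw [card_cusp_regeom]
  have h5 : 5 ≤ l := D₀.five_le_l
  omega

end Regeom

end InitialThetaData

end Literature.IUT.HodgeTheaters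

end
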